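import Literature.NumberTheory.EllipticCurves.KuriharaNumberKimNonvanishing
import Literature.NumberTheory.EllipticCurves.ModularCurvePeriodRatio
import Literature.NumberTheory.EllipticCurves.NonEisensteinPrimeOfSurjective
import HarnessLib

/-!
# BirchSwinnertonDyer / SelmerRank — crux `SelmerRankLB` (stmt-BirchSwinnertonDyer-0131),
# line `kurihara_order`, stub **K** `stub_kim_order_le_corank`: closure modulo three named facts

Registered stub **K** of the skeleton `Cruxes/SelmerRankLB/Lines/kurihara_order.lean` (the ONLY
place where Selmer groups enter the line): for a globally minimal elliptic `W/ℚ` and a prime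
`p ≥ 5` of good ordinary reduction with `ρ̄_{E,p}` surjective, the conductor `N_E` is positive, `E`
has a newform `f ∈ S₂(Γ₀(N_E))`, and there are a level `k ≥ 1`, a square-free product `n ∈ 𝒩_k` of
Kolyvagin primes with `ν(n) ≤ corank_{ℤ_p} Sel_{p^∞}(E/ℚ)` and surjective discrete logarithms
`ψ_ℓ : (ℤ/ℓ)ˣ → ℤ/p^k` with `kuriharaNumber f (p^k) n ψ ≠ 0`.

This is the NON-VANISHING direction of C.-H. Kim's structure theorem (arXiv:2203.12159 =
Amer. J. Math., Thm. 1.9 (1): `cork_{ℤ_p} Sel(ℚ, E[p^∞]) = ord(δ̃)`, with Cor. 1.6: `ord(δ̃) < ∞` at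
a good ordinary `p`, the main conjecture localised at `XΛ` being a theorem there — Kato 2004,
Thm. 17.4 with Burungale–Castella–Skinner 2025, Thm. 1.1.2), a theorem in print of size XL
(Mazur–Rubin Kolyvagin systems, Büyükboduk's `Λ`-adic rigidity, Kato's explicit reciprocity law in
Kolyvagin-derived form = Kim Thm. 3.13, the main conjecture), none of which exists in Mathlib or in
the tree. The stub is therefore proved here RELATIVE to three named facts of the tree:

* `Literature.NumberTheory.EllipticCurves.ModularForms.exists_isNewformOf` (`CuspFormLFunction`):
  modularity, BCDT 2001 Thm. A, at level `N_E` (Carayol) — it IS the `∃ f, IsNewformOf W f` that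
  the stub asserts;
* `Literature.NumberTheory.EllipticCurves.Kim2022_exists_kuriharaNumber_ne_zero_of_selmerCorank`
  (F1, `KuriharaNumberKimNonvanishing`): Kim Thm. 1.9 (1) + Cor. 1.6 in the tree's vocabulary
  (`kuriharaNumber`, `Kato.IsKolyvaginProduct`, `selmerCorank`), under the explicit period
  transfer `Ω(W) = u · Ω⁺_f`, `u ∈ ℚ`, `|u|_p = 1` (the tree's `ratPlusSymbol`/`kuriharaNumber` are
  normalised by `Ω⁺_f = plusPeriod f`, Kim's `[r]⁺`, `δ̃_n` by the Néron period
  `Ω⁺_E = W.realPeriodRat`; under the transfer `kuriharaNumber f (p^k) n ψ = ū · δ̃_n^{(k)}`,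
  `ū ∈ (ℤ/p^k)ˣ`);
* `Literature.NumberTheory.EllipticCurves.realPeriodRat_eq_unit_mul_plusPeriod` (F2,
  `ModularCurvePeriodRatio`): at a good `p ≥ 5` with `E[p]` irreducible the transfer holds with a
  rational `p`-adic unit (Manin constant of the strong Weil curve prime to `p ∤ N`: Abbes–Ullmo
  1996 Thm. A / Mazur 1978 Cor. 4.1; isogeny of degree prime to `p` inside the class:
  Greenberg–Vatsal 2000, Remark 3.4).

`stub_kim_order_le_corank_of_facts` assembles the registered signature verbatim behind the three
hypotheses: `NeZero N_E` is the PROVED `WeierstrassCurve.conductorNorm_pos_holds`, irreducibility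
comes from surjectivity (`hasIrreducibleModPGaloisRep_of_hasSurjectiveModNGaloisRep`), F2 feeds
F1's period hypothesis, F1 gives `k, n, ψ`. CONDITIONAL: it closes stub K only modulo
{modularity, F1, F2}; the registered unconditional signature stays open until their `_holds`.

Not here: the UPPER direction of Kim's theorem (`corank ≤ ν(n)` from a non-vanishing `δ̃_n`:
`Kim2022_selmerCorank_le_of_kuriharaNumber_ne_zero`, `KuriharaNumberKimStructure`, stub V2a's
input); any Selmer-group computation.
-/

set_option linter.dupNamespace false

noncomputable section

namespace Summit.BirchSwinnertonDyer.BirchSwinnertonDyer.Theorems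

open scoped MatrixGroups ModularForm Classical
open CongruenceSubgroup Literature.NumberTheory.EllipticCurves
  Literature.NumberTheory.EllipticCurves.ModularForms WeierstrassCurve

/-- **Stub K (`stub_kim_order_le_corank`) of line `kurihara_order`, closed MODULO the named facts
`exists_isNewformOf` (modularity, BCDT 2001 Thm. A, level `N_E` by Carayol),
`Kim2022_exists_kuriharaNumber_ne_zero_of_selmerCorank` (F1: Kim 2022 Thm. 1.9 (1) + Cor. 1.6) and
`realPeriodRat_eq_unit_mul_plusPeriod` (F2: the period transfer is a rational `p`-adic unit).**
Behind the three hypotheses the conclusion is the registered signature verbatim: for globally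
minimal elliptic `W/ℚ` and `p ≥ 5` good ordinary with `ρ̄_{E,p}` onto, `N_E ≠ 0`
(`WeierstrassCurve.conductorNorm_pos_holds`, proved), a newform `f ∈ S₂(Γ₀(N_E))` of `W`
(modularity), and `k ≥ 1`, `n ∈ 𝒩_k` with `ν(n) ≤ cork_p Sel_{p^∞}(E/ℚ)` and surjective `ψ` with
`kuriharaNumber f (p^k) n ψ ≠ 0` (F1, whose period hypothesis is F2 at the irreducible — because
surjective, `hasIrreducibleModPGaloisRep_of_hasSurjectiveModNGaloisRep` — prime `p`). CONDITIONAL;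
it does not close the stub. [cite: Kim2022StructureSelmer, Thm. 1.9 (1) (p. 7) and Cor. 1.6 (p. 6)] -/
theorem stub_kim_order_le_corank_of_facts :
    exists_isNewformOf → Kim2022_exists_kuriharaNumber_ne_zero_of_selmerCorank →
      realPeriodRat_eq_unit_mul_plusPeriod →
      ∀ (W : WeierstrassCurve ℚ) [W.IsElliptic] [W.IsGloballyMinimal] (p : ℕ) [Fact p.Prime],
        5 ≤ p → W.HasGoodReductionAtPrime p → ¬ (p : ℤ) ∣ W.frobeniusTrace p →
        W.HasSurjectiveModNGaloisRep p →
        ∃ (_ : NeZero (W.conductorNorm ℤ)) (f : CuspForm (Gamma0 (W.conductorNorm ℤ)) 2),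
          IsNewformOf W f ∧
          ∃ (k n : ℕ) (_ : NeZero n), 1 ≤ k ∧ Kato.IsKolyvaginProduct W p k n ∧
            n.primeFactors.card ≤ W.selmerCorank p ∧
            ∃ ψ : (ℓ : ℕ) → (ZMod ℓ)ˣ →* Multiplicative (ZMod (p ^ k)),
              (∀ ℓ ∈ n.primeFactors, Function.Surjective (ψ ℓ)) ∧
              kuriharaNumber f (p ^ k) n ψ ≠ 0 := by
  intro hmod hF1 hF2 W _ _ p _ h5 hgood hord hsurj
  haveI hN : NeZero (W.conductorNorm ℤ) := ⟨(W.conductorNorm_pos_holds).ne'⟩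
  obtain ⟨f, hf⟩ := hmod W
  have hirr : W.HasIrreducibleModPGaloisRep p :=
    hasIrreducibleModPGaloisRep_of_hasSurjectiveModNGaloisRep W p hsurj
  obtain ⟨k, n, hn, hk, hkoly, hle, ψ, hψ, hne⟩ :=
    hF1 W p h5 hgood hord hsurj f hf (hF2 W p h5 hgood hirr f hf)
  exact ⟨hN, f, hf, k, n, hn, hk, hkoly, hle, ψ, hψ, hne⟩

end Summit.BirchSwinnertonDyer.BirchSwinnertonDyer.Theorems

end
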